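import Mathlib
import HarnessLib
import HarnessLib.Audit
import Summits.NavierStokesRegularity.Statement
import Literature.Claims.NS.ClayR3SuitableWeakBridge
import Literature.Analysis.FluidPDE.LocalEnergySolutionsOn
import Literature.Analysis.FluidPDE.CKNEpsilonRegularityAssemblyProofs
import HarnessLib.Audit.Status.Attr

/-!
Route: RootDecompClassDescent

# Route RootDecompClassDescent — Clay (A) iff Leray uniqueness inside the Leray–CKN class and unique
Leray–CKN flows are regular (root residual U descended to the CKN class)

ROOT DECOMPOSITION CELL decomp-ns (D-0178), node N23 «THE CLASS DESCENT» (lens-3 g10; CRITIC-LEDGER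
row 123 CLEARED, modest: organisational
RESIDUAL DESCENT with an honest typed gap). It suffices to show X = SU° ∧ B°, and the node is EXACT
AT THE ROOT (S ⟺ SU° ∧ B°, kernel `root_iff`
in the writer Sketch = lens `summit_iff_class`): SU° `LerayCKNUniqueness` = Leray uniqueness INSIDE
the Leray–CKN class (two global Leray–Hopf weak
solutions from the same Clay datum which, with pressures, are local-energy (CKN-suitable) solutions
on every strip agree a.e. at every t > 0);
B° `UniqueLerayCKNFlowsRegular` = «suitable singularities branch suitably»: for every Clay datum
whose Leray–CKN flows are unique among
themselves, every Leray–CKN flow from it is regular (CKN §6) at every point of positive time. The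
node DESCENDS the declared ROOT RESIDUAL U
`ClayLerayHopfUniqueness` (stmt-NavierStokesRegularity-25531, N3 `RootDecompLerayBranching`,
residual of the whole N3/N6/N21 lineage since g1)
to the strictly weaker SU° ⊊ U, with the gap typed exactly: U ⟺ SU° ∧ AS, AS `ClayFlowsAreLerayCKN`
= CKN's 1982 question on Clay data
(every global Leray–Hopf flow from a Clay datum agrees on every (0,T] with a Leray–CKN flow) —
S-necessary, PROVED MOOT for (A) (`SU° → B° → AS`
through S) and therefore filed as an ASIDE, not on the summit path. Both doors used are TREE
THEOREMS (`clayR3_regularity_iff_suitableLerayHopf_regular`,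
census A09, used by no node before; N3's `translation_iff`, A08), so the node posits no equivalence
of its own (the single EQUIV layer is a cite,
COSTUME(cite), with the AND split SU° ∧ B° beneath it — D-0171 admissible).
Lean: `LerayCKNUniqueness ∧ UniqueLerayCKNFlowsRegular`

## Assembly
Pure logic through the tree door: `closes (hSU) (hB) : NavierStokesRegularity` rewrites S as
`clayR3.Regularity` (`Iff.rfl`), applies
`Literature.Claims.NS.ClayVariants.clayR3_regularity_iff_suitableLerayHopf_regular.2` and feeds B°
the uniqueness hypothesis supplied by SU° at the
datum (2/2 binders consumed; certified `ledger route check --native`). EXACT: `root_iff :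
NavierStokesRegularity ↔ SU° ∧ B°` (writer Sketch, rc 0;
necessity by the theorems `lerayHopf_unique_of_clayA`, `isRegularPoint_of_clayR3_regularityAt`, not
by vacuity). PROVENANCE: critic CRITIC-LEDGER row 123 (2026-08-30T11:19:13Z, decomp-ns-crit-1-g3)
CLEARED «modest, organisational residual descent, honest typed gap»; lens files
HOME/decomp-ns-lens-3/landable/ClassDescent.lean sha256
afede722d117e518ceed0b1c50e3624db688fd9f262a087e000e699a90a3edfc (133 lines), LerayBranchingG10.lean
sha256 f9fd1e75b1352ee4eccb1fcccb8333beff5bfb033fd3fe47f629067b9ecf5040, NODE-g10.md sha256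
22b9bedd…; census HOME/census/COSTUME-CENSUS-v9.md sha256
ebc95e3cbce4add10c9cf3a056c7953d714b9245702ac989bc9e6428e270041f (418 lines; rows C65/H76/C13/A09);
writer BC7 probe classdesc/bc/Probe.out.txt sha256
c71e866fd50a9e70774d57d19be3705369ec3aefc29d9912401d7a0f584ba6a0 (3/3 VERDICT CLEAN: SU° P3 timeout,
B° P3+P5 timeout, AS all batteries ran).

Rationale: WHY THIS LINE. Nine lens-3 generations (and every other lens) read the FLOW of a putative non-unique
continuation (breakdown type, trace tangent, scar, germ,
ill-posed data, epochs, faces, arrival); the coordinate never read is the SOLUTION CLASS over which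
the uniqueness residual quantifies. U asks
uniqueness among ALL global Leray–Hopf flows; every instrument the cell owns — ε-regularity /
partial regularity (CaffarelliKohnNirenberg1982),
ESS backward uniqueness, persistence of singularities and the local Type-I theory (arXiv:1811.00502
Def 2.1, Prop 2.3), and EVERY second-solution
mechanism in print (JiaSverak2015, GuillodSverak2023, AlbrittonBrueColombo2022 «suitable with
equality in the local energy inequality»,
Hou–Wang–Yang 2025) — lives in the Leray–CKN class. Restricting U to that class (SU°) REMOVES
content U carried for nothing: the complement AS is
S-necessary but unused on the summit path (kernel `clayFlowsAreLerayCKN_of_class`). Imported: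
Prodi–Serrin weak–strong uniqueness (tree
`weak_strong_uniqueness_holds`), Leray–CKN existence from Clay data (tree
`exists_suitable_globalLerayHopf_of_clayDatum`), the CKN-class door (tree
`clayR3_regularity_iff_suitableLerayHopf_regular`, LemarieRieusset2016 Thm 15.1/Prop 12.3). What no
prior route does: no route of the summit (rg over
Theses/ for LocalEnergySolutionOn / suitableLerayHopf_regular: only the door's own Literature file)
states a uniqueness or regularity crux over the
Leray–CKN class; the negatives index entry 0154 (Clay-class SMOOTH uniqueness, Tao 2013 Cor. 11.4)
concerns almost-smooth solutions, not weak ones.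

RANKED CRUXES. #2 LerayCKNUniqueness (crux) — SU° — Leray uniqueness inside the Leray–CKN class: for
every ν > 0 and Clay datum u₀, two global Leray–Hopf weak solutions from u₀ which (with pressures)
are local energy solutions on every strip (0,T) agree a.e. at every t > 0. THE DESCENDED ROOT
RESIDUAL (replaces U 25531 in that role; U ⟹ SU° kernel `lerayCKNUniqueness_of_U`; S ⟹ SU° by
theorem). DECLARED RESIDUAL · WEAKER · UNDECIDED · IDEA-NEEDED (positive side) · INSTRUMENTABLE
(negative side: every branching certificate of the cell produces Leray–CKN competitors).
[difficulty: open-problem] (why it might fail: a Jia–Šverák/Guillod–Šverák-type bifurcation from a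
(−1)-homogeneous or DSS profile realised from SMOOTH decaying data gives two suitable Leray–Hopf
flows — both in the Leray–CKN class — past the first blow-up.) [JiaSverak2015, GuillodSverak2023,
AlbrittonBrueColombo2022, CaffarelliKohnNirenberg1982, LemarieRieusset2016, arXiv:1811.00502]
#3 UniqueLerayCKNFlowsRegular (crux) — B° — «suitable singularities branch suitably»: for every ν >
0 and Clay datum u₀ whose Leray–CKN flows are unique among themselves, every Leray–CKN flow from u₀
is regular (`IsRegularPoint`, CKN §6) at every point (t,x) with t > 0 (contrapositive: a SINGULAR
Leray–CKN flow from a Clay datum has a Leray–CKN SIBLING). ATTACKED conjunct of the node (engines: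
CKN/Lin ε-regularity, ESS, Albritton–Barker local Type I now apply to EVERY competitor, all being
suitable); WEAKER than S (S ⟹ B° by `isRegularPoint_of_clayR3_regularityAt`, hypothesis unused);
piece-wise INCOMPARABLE with N3's B `BreakdownHasMaximalSolution`-side pieces (jointly equivalent:
lens `node₁_iff_node₁₇`). IDEA-NEEDED at full strength. [difficulty: open-problem] (why it might
fail: a quiet suitable Type-II blow-up from smooth data with a UNIQUE Leray–CKN continuation (no
instability to branch on) makes B° false while SU° holds — the U ∧ ¬S world.)
[CaffarelliKohnNirenberg1982, JiaSverak2015, arXiv:1811.00502, LemarieRieusset2016,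
GuillodSverak2023]
#9 ClayFlowsAreLerayCKN (support) — AS (ASIDE, banked; NOT on the summit path) — CKN's question on
Clay data: every global Leray–Hopf weak solution from a Clay datum agrees on every (0,T] with a
Leray–CKN flow from the same datum. THE EXACT GAP of the descent: U(25531) ⟺ SU° ∧ AS (kernel
`clayUniqueness_iff_class`); S ⟹ AS and SU° → B° → AS (moot). ATTACKABLE-PARTIAL: decided below the
first singular epoch by Prodi–Serrin (lens `lerayCKNBefore_of_essBdd`, tree
`weak_strong_uniqueness_holds`); IDEA-NEEDED past it. [difficulty: open-problem]
[CaffarelliKohnNirenberg1982, LemarieRieusset2016, arXiv:1605.04688]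

TWO-LAYER PLAN. Foreseen (not filed): B° ⇐ B°_I → B°_II → B° by arrival type of the first singular
epoch of the Leray–CKN flow (N21's ARRIVAL RECUT restricted to
the class: Type-I epoch face via persistence of singularities + local Type I, arXiv:1811.00502;
Type-II face residual); SU° ⇐ «no class branching
at a suitable epoch» once the grafting lemmas (tree `IsLocalEnergySolutionOn.concat`,
`IsLerayHopfOn.concat`) are exercised (lens-3 g11).

KILL CRITERIA. A pair of distinct Leray–CKN flows from one smooth rapidly decaying datum
(JiaSverak2015 / GuillodSverak2023 scenario made rigorous from smooth
data) refutes SU° and, by `root_iff`, Clay (A) itself — the route then closes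
`refuted:LerayCKNUniqueness` and the summit is decided negatively
through (C) (`navierStokesRegularity_or_breakdownR3`). A singular Leray–CKN flow with provably
unique class continuation refutes B° (same
consequence). ONE Leray–Hopf flow from ONE Clay datum with no suitable representative on one slab
refutes AS and (A) (lens kill switch
`not_summit_of_unsuitable`) without touching SU°/B°. Proved elsewhere: any proof of U 25531 gives
SU° (edge); any proof of S moots everything.

NOT DECOMPOSED YET. B°'s faces by arrival type (Two-layer plan) and SU°'s epoch form — both need the
class-grafting kernel (lens-3 g11) first; AS's open half (past
the first singular epoch, `clayFlowsAreLerayCKN_iff_pastFirstSingularEpoch`) is banked, not staffed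
(aside). No constants to fix.

CHEAPEST FALSIFIER. Lookup, run by the lens and re-run by the writer: is there a tree/Literature
theorem of shape SU° → S or B° → S (rg `LocalEnergySolutionOn.*Regular`,
`suitableLerayHopf_regular`)? Only the door A09, which needs BOTH — so neither piece is the summit
in costume (BC2/BC7 P5 did not close). The
cheapest mathematical kill is the JS2015 spectral condition: a verified unstable eigenvalue for the
linearisation at a (−1)-homogeneous profile
reachable from smooth data would (with Guillod–Šverák numerics made rigorous) produce two Leray–CKN
flows.

Novelty: Searches (2026-08-30, lens-3 g10 + writer): lit search --hybrid "every weak solution suitable open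
question local energy inequality Leray-Hopf" →
[corpus:lemarie-rieusset2016 p.142] (Galerkin solutions: suitability unknown), [corpus:robinson2016
pp.202–210]; lit vsearch "not known whether every
Leray–Hopf weak solution satisfies the local energy inequality" → seregin2014 pp.77–150, LR2016; lit
search "Biryuk Craig Ibrahim suitable weak
solutions Galerkin" --source all → [corpus:w3100360279 p.2] (Berselli 2018: «which solutions are
suitable … left open for twenty years»),
[corpus:arxiv-1605.04688 p.4 L105], [graph:doi:10.1090/conm/429/08226],
[graph:doi:10.1016/j.matpur.2007.04.009]; lit galaxy search "every weak
solution is suitable|weak solutions are suitable|not known whether every weak solution" --star all →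
no relevant hits; lit galaxy search
"Leray-Hopf solutions are suitable|whether they are suitable|class of suitable weak solutions"
--star all → no relevant hits; tree: rg
«suitableLerayHopf_regular|SuitableWeakBridge|LocalEnergySolution» over the 169 Theses files and
HOME/STATUS.md, TREE.md, CRITIC-LEDGER.md → 0 route
uses (door A09 catalogued-unused in census v8); ledger negatives --problem NavierStokesRegularity →
5 entries, none over the Leray–CKN class (0154 is
SMOOTH-class uniqueness, Tao 2013 Cor. 11.4).
Nearest prior art found: the tree door A09 itself (LemarieRieusset2016 Thm 15.1 (C)/Prop 12.3;
CaffarelliKohnNirenberg1982 Appendix) — used and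
cited, COSTUME(ci  [refs: 10.1090/conm/429/08226, 10.1016/j.matpur.2007.04.009, arxiv-1605.04688, doi:10.1090/conm/429/08226, doi:10.1016/j.matpur.2007.04.009, LemarieRieusset2016, CaffarelliKohnNirenberg1982]

Barriers (technique_class: weak-strong-uniqueness, local-energy-class, eps-regularity): - technique_class: weak-strong-uniqueness, local-energy-class, eps-regularity
- Literature.Barriers.NavierStokesRegularity.ForcedLerayHopfNonuniquenessNarrow: SU° sits INSIDE its
shadow by design and is not excluded by it — the barrier's witnesses (AlbrittonBrueColombo2022) are
suitable Leray–Hopf pairs for a critically singular FORCE with u₀ = 0; SU° quantifies over the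
UNFORCED system with Clay data, which the barrier file itself records as untouched («(c) For
Clay-type data … nothing printed bears on this case»); the bet is exactly Leray's question in class.
- Literature.Barriers.NavierStokesRegularity.HypodissipativeLerayNonuniqueness: outside — Colombo–De
Lellis–De Rosa solutions are for (−Δ)^α, α < 1/3..1/2, not Leray–Hopf for the true Laplacian; SU°/B°
are ν Δ statements.
- Literature.Barriers.NavierStokesRegularity.CriticalDataSmoothNonuniqueness: outside — Clay data
are Schwartz, the local smooth solution exists and is unique (negatives 0154 / Tao 2013 Cor. 11.4);
non-uniqueness in SU° can only be born past a blow-up, which is the content.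
- Literature.Barriers.NavierStokesRegularity.BuckmasterVicolNonuniqueness: outside —
convex-integration weak solutions are not Leray–Hopf (no energy inequality), a fortiori not
Leray–CKN.
- Literature.Barriers.NavierStokesRegularity.NavierStokesInequalitySingularSolution: B° is typed
over solutions of the EQUATION (`IsLocalEnergySolutionOn` carries the weak NSE and the pressure
law), not over Scheffer/Ożański weak solutions of the

sub-problem: NavierStokesRegularity · status: open · opened planner-decomp-ns-writer-1-g5-0 2026-08-30T12:01:51Z · rev 0 · ledger route-NavierStokesRegularity-RootDecompClassDescent
GENERATED by the gate from the ledger (D-0016/17). Provers cite these decls: `theorem foo : Summit.NavierStokesRegularity.NavierStokesRegularity.Theses.RootDecompClassDescent.<Decl> := …` in Summits/NavierStokesRegularity/NavierStokesRegularity/Theorems/<Name>.lean.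
-/

namespace Summit.NavierStokesRegularity.NavierStokesRegularity.Theses.RootDecompClassDescent

open scoped BigOperators Topology Manifold Classical MeasureTheory ProbabilityTheory Matrix InnerProductSpace ComplexConjugate ContinuousMap
open Filter Set Function TopologicalSpace MeasureTheory

attribute [summit_statement] _root_.NavierStokesRegularity

open Literature.NS

/-- item stmt-NavierStokesRegularity-32859 · crux · rank 2 · open · by planner
why it might fail: a Jia–Šverák/Guillod–Šverák-type bifurcation from a (−1)-homogeneous or DSS profile realised from SMOOTH decaying data gives two suitable Leray–Hopf flows — both in the Leray–CKN class — past the first blow-up.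
sources: JiaSverak2015, GuillodSverak2023, AlbrittonBrueColombo2022, CaffarelliKohnNirenberg1982, LemarieRieusset2016, arXiv:1811.00502
[crux] SU° — Leray uniqueness inside the Leray–CKN class: for every ν > 0 and Clay datum u₀, two
global Leray–Hopf weak solutions from u₀ which (with pressures) are local energy solutions on every
strip (0,T) agree a.e. at every t > 0. THE DESCENDED ROOT RESIDUAL (replaces U 25531 in that role; U
⟹ SU° kernel `lerayCKNUniqueness_of_U`; S ⟹ SU° by theorem). DECLARED RESIDUAL · WEAKER · UNDECIDED
· IDEA-NEEDED (positive side) · INSTRUMENTABLE (negative side: every branching certificate of the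
cell produces Leray–CKN competitors). [difficulty: open-problem] [critic row 123 CLEARED
2026-08-30T11:19:13Z; census v9 sha256 ebc95e3c… rows C65/H76] -/
@[route_item "route-NavierStokesRegularity-RootDecompClassDescent", crux]
def LerayCKNUniqueness : Prop :=
  ∀ ν : ℝ, 0 < ν → ∀ u₀ : EuclideanSpace ℝ (Fin 3) → EuclideanSpace ℝ (Fin 3), ContDiff ℝ ((⊤ : ℕ∞) : WithTop ℕ∞) u₀ → Literature.Analysis.FluidPDE.NSWave0.IsDivFree u₀ → Literature.Analysis.FluidPDE.HasRapidSpatialDecay u₀ → ∀ (v : ℝ → EuclideanSpace ℝ (Fin 3) → EuclideanSpace ℝ (Fin 3)) (p : ℝ → EuclideanSpace ℝ (Fin 3) → ℝ) (w : ℝ → EuclideanSpace ℝ (Fin 3) → EuclideanSpace ℝ (Fin 3)) (q : ℝ → EuclideanSpace ℝ (Fin 3) → ℝ), (Literature.Analysis.FluidPDE.IsGlobalLerayHopf ν 0 u₀ v ∧ ∀ T : ℝ, 0 < T → Literature.Analysis.FluidPDE.IsLocalEnergySolutionOn T ν u₀ v p) → (Literature.Analysis.FluidPDE.IsGlobalLerayHopf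 ν 0 u₀ w ∧ ∀ T : ℝ, 0 < T → Literature.Analysis.FluidPDE.IsLocalEnergySolutionOn T ν u₀ w q) → ∀ t : ℝ, 0 < t → v t =ᵐ[MeasureTheory.volume] w t

/-- item stmt-NavierStokesRegularity-32860 · crux · rank 3 · open · by planner
why it might fail: a quiet suitable Type-II blow-up from smooth data with a UNIQUE Leray–CKN continuation (no instability to branch on) makes B° false while SU° holds — the U ∧ ¬S world.
sources: CaffarelliKohnNirenberg1982, JiaSverak2015, arXiv:1811.00502, LemarieRieusset2016, GuillodSverak2023
[crux] B° — «suitable singularities branch suitably»: for every ν > 0 and Clay datum u₀ whose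
Leray–CKN flows are unique among themselves, every Leray–CKN flow from u₀ is regular
(`IsRegularPoint`, CKN §6) at every point (t,x) with t > 0 (contrapositive: a SINGULAR Leray–CKN
flow from a Clay datum has a Leray–CKN SIBLING). ATTACKED conjunct of the node (engines: CKN/Lin
ε-regularity, ESS, Albritton–Barker local Type I now apply to EVERY competitor, all being suitable);
WEAKER than S (S ⟹ B° by `isRegularPoint_of_clayR3_regularityAt`, hypothesis unused); piece-wise
INCOMPARABLE with N3's B `BreakdownHasMaximalSolution`-side pieces (jointly equivalent: lens
`node₁_iff_node₁₇`). IDEA-NEEDED at full strength. [difficulty: open-problem] [critic row 123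
CLEARED 2026-08-30T11:19:13Z; census v9 sha256 ebc95e3c… rows C65/H76] -/
@[route_item "route-NavierStokesRegularity-RootDecompClassDescent", crux]
def UniqueLerayCKNFlowsRegular : Prop :=
  ∀ ν : ℝ, 0 < ν → ∀ u₀ : EuclideanSpace ℝ (Fin 3) → EuclideanSpace ℝ (Fin 3), ContDiff ℝ ((⊤ : ℕ∞) : WithTop ℕ∞) u₀ → Literature.Analysis.FluidPDE.NSWave0.IsDivFree u₀ → Literature.Analysis.FluidPDE.HasRapidSpatialDecay u₀ → (∀ (v : ℝ → EuclideanSpace ℝ (Fin 3) → EuclideanSpace ℝ (Fin 3)) (p : ℝ → EuclideanSpace ℝ (Fin 3) → ℝ) (w : ℝ → EuclideanSpace ℝ (Fin 3) → EuclideanSpace ℝ (Fin 3)) (q : ℝ → EuclideanSpace ℝ (Fin 3) → ℝ), (Literature.Analysis.FluidPDE.IsGlobalLerayHopf ν 0 u₀ v ∧ ∀ T : ℝ, 0 < T → Literature.Analysis.FluidPDE.IsLocalEnergySolutionOn T ν u₀ v p) → (Literature.Analysis.FluidPDE.IsGlobalLerayHopf ν 0 u₀ w ∧ ∀ T : ℝ,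 0 < T → Literature.Analysis.FluidPDE.IsLocalEnergySolutionOn T ν u₀ w q) → ∀ t : ℝ, 0 < t → v t =ᵐ[MeasureTheory.volume] w t) → ∀ (v : ℝ → EuclideanSpace ℝ (Fin 3) → EuclideanSpace ℝ (Fin 3)) (p : ℝ → EuclideanSpace ℝ (Fin 3) → ℝ), (Literature.Analysis.FluidPDE.IsGlobalLerayHopf ν 0 u₀ v ∧ ∀ T : ℝ, 0 < T → Literature.Analysis.FluidPDE.IsLocalEnergySolutionOn T ν u₀ v p) → ∀ z : ℝ × EuclideanSpace ℝ (Fin 3), 0 < z.1 → Literature.Analysis.FluidPDE.IsRegularPoint v z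

/-- item stmt-NavierStokesRegularity-32861 · aside · rank 9 · open · by planner
sources: CaffarelliKohnNirenberg1982, LemarieRieusset2016, arXiv:1605.04688
[aside] AS (ASIDE, banked; NOT on the summit path) — CKN's question on Clay data: every global
Leray–Hopf weak solution from a Clay datum agrees on every (0,T] with a Leray–CKN flow from the same
datum. THE EXACT GAP of the descent: U(25531) ⟺ SU° ∧ AS (kernel `clayUniqueness_iff_class`); S ⟹ AS
and SU° → B° → AS (moot). ATTACKABLE-PARTIAL: decided below the first singular epoch by Prodi–Serrin
(lens `lerayCKNBefore_of_essBdd`, tree `weak_strong_uniqueness_holds`); IDEA-NEEDED past it.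
[difficulty: open-problem] [critic row 123 CLEARED 2026-08-30T11:19:13Z; census v9 sha256 ebc95e3c…
rows C65/H76] -/
@[route_item "route-NavierStokesRegularity-RootDecompClassDescent"]
def ClayFlowsAreLerayCKN : Prop :=
  ∀ ν : ℝ, 0 < ν → ∀ u₀ : EuclideanSpace ℝ (Fin 3) → EuclideanSpace ℝ (Fin 3), ContDiff ℝ ((⊤ : ℕ∞) : WithTop ℕ∞) u₀ → Literature.Analysis.FluidPDE.NSWave0.IsDivFree u₀ → Literature.Analysis.FluidPDE.HasRapidSpatialDecay u₀ → ∀ u : ℝ → EuclideanSpace ℝ (Fin 3) → EuclideanSpace ℝ (Fin 3), Literature.Analysis.FluidPDE.IsGlobalLerayHopf ν 0 u₀ u → ∀ T : ℝ, 0 < T → ∃ (v : ℝ → EuclideanSpace ℝ (Fin 3) → EuclideanSpace ℝ (Fin 3)) (p : ℝ → EuclideanSpace ℝ (Fin 3) → ℝ), (Literature.Analysis.FluidPDE.IsGlobalLerayHopf ν 0 u₀ v ∧ ∀ T' : ℝ, 0 < T' → Literature.Analysis.FluidPDE.IsLocalEnergySolutionOn T' ν u₀ v p) ∧ ∀ t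 ∈ Set.Ioc 0 T, v t =ᵐ[MeasureTheory.volume] u t

/-- item stmt-NavierStokesRegularity-32862 · assembly · rank 1 · open · by planner
sources: CaffarelliKohnNirenberg1982, LemarieRieusset2016
[assembly] SU° → B° → Clay (A). -/
@[route_item "route-NavierStokesRegularity-RootDecompClassDescent"]
def Assembly : Prop :=
  LerayCKNUniqueness → UniqueLerayCKNFlowsRegular → NavierStokesRegularity

/-! D-0027 §2.1 — DECIDING THEOREM (planner-authored via `route open/edit --closes-file`; by planner-decomp-ns-writer-1-g5-0 2026-08-30T12:01:51Z):
its hypotheses are this route's items and its conclusion the sub-problem Statement (glue_lint), and it elaborates with this file. -/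

@[closes "route-NavierStokesRegularity-RootDecompClassDescent"] theorem closes (hSU : LerayCKNUniqueness) (hB : UniqueLerayCKNFlowsRegular) : NavierStokesRegularity :=
  have e : NavierStokesRegularity ↔ Literature.Claims.NS.ClayVariants.clayR3.Regularity := Iff.rfl
  e.2 (Literature.Claims.NS.ClayVariants.clayR3_regularity_iff_suitableLerayHopf_regular.2 fun ν hν u₀ h₁ h₂ h₃ v p hv hLE z hz =>
    hB ν hν u₀ h₁ h₂ h₃ (hSU ν hν u₀ h₁ h₂ h₃) v p ⟨hv, hLE⟩ z hz)

end Summit.NavierStokesRegularity.NavierStokesRegularity.Theses.RootDecompClassDescent
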